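import Mathlib
import Summits.MatrixMultiplication.MatrixMultiplication.Theorems.SnSubsetDichotomyHyperoctahedralThresholdCleanPairInherit
import Summits.MatrixMultiplication.MatrixMultiplication.Theorems.SnSubsetDichotomyHyperoctahedralThresholdTransporter

/-!
# Clean-pair atom — the hop, counting core

Helper for crux `SnSubsetDichotomy.HyperoctahedralThreshold` (stmt-MatrixMultiplication-10883), line
`Lines/stub_plan_poorRigidCore.md`, proof plan `work/ATOM_PROOF.md` §4 of the stub-plan prover seat.

* `tr_lt_cheap`, `tr_lt_big`: the transporter bound at a non-dense source in the two regimes (`2^(t+1) ≤ 3s₀` / beyond).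
* `hop_core`: early touchers of a hub inject class-wise into the transporter words; if no full-prefix class is GOOD (triples the
  density in the cheap regime, multiplies it by `√s₀/(64(d+1)²)` in the big regime) then `32(d+1)²·#(touchers of each time) < |S|`,
  contradicting `|S| - 1 ≤ 8(d+1)·#touchers`.
-/

-- the tree's namespace `Summit.MatrixMultiplication.MatrixMultiplication.…` repeats a component by design
set_option linter.dupNamespace false

namespace Summit.MatrixMultiplication.MatrixMultiplication.Theorems.HyperoctahedralThreshold

namespace CleanPair

open TwinSupplyCS

variable {n : ℕ}

section Main

variable {μ : Fin 3 → Equiv.Perm (Fin n)} {F : Finset (Fin n)} {r : ℕ}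


/-- Transporter count at a non-dense source, CHEAP regime: if `2^(t+1) ≤ 3 s₀` then fewer than `3·2^⌈t/2⌉` reduced words
of length `t` carry `y` to any fixed `u`. -/
theorem tr_lt_cheap (hμ : ∀ c, μ c * μ c = 1) {s₀ t : ℕ} (hs₀ : 0 < s₀) (y u : Fin n)
    (hsparse : ∀ m, 1 ≤ m → m ≤ 2 * t → s₀ * (closedAt μ m y).card ≤ 2 ^ m) (hcheap : 2 ^ (t + 1) ≤ 3 * s₀) :
    ((RW t).filter fun w => act μ y w = u).card < 3 * 2 ^ ((t + 1) / 2) := by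
  set tr := ((RW t).filter fun w => act μ y w = u).card
  have h := Transporter.card_trAt_sq_le_of_sparse μ (involutive_of_mul_self μ hμ) t s₀ y u hsparse
  -- s₀ tr² ≤ 3 s₀ 2^t + 2^t · 2^(t+1) ≤ 6 s₀ 2^t
  have h4 : 2 * 4 ^ t = 2 ^ t * 2 ^ (t + 1) := by
    rw [show (4 : ℕ) = 2 ^ 2 by norm_num, ← pow_mul, pow_succ]; ring
  have h1 : s₀ * tr ^ 2 ≤ s₀ * (6 * 2 ^ t) := by
    calc s₀ * tr ^ 2 ≤ 3 * s₀ * 2 ^ t + 2 * 4 ^ t := h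
      _ ≤ 3 * s₀ * 2 ^ t + 2 ^ t * (3 * s₀) := by rw [h4]; exact Nat.add_le_add_left (Nat.mul_le_mul_left _ hcheap) _
      _ = s₀ * (6 * 2 ^ t) := by ring
  have h2 : tr ^ 2 ≤ 6 * 2 ^ t := Nat.le_of_mul_le_mul_left h1 hs₀
  have h3 : tr ^ 2 < (3 * 2 ^ ((t + 1) / 2)) ^ 2 := by
    have hj : 2 ^ t ≤ 2 ^ (((t + 1) / 2) * 2) := Nat.pow_le_pow_right (by norm_num) (by omega)
    have hjpos : 0 < 2 ^ (((t + 1) / 2) * 2) := by positivity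
    calc tr ^ 2 ≤ 6 * 2 ^ t := h2
      _ ≤ 6 * 2 ^ (((t + 1) / 2) * 2) := Nat.mul_le_mul_left _ hj
      _ < 9 * 2 ^ (((t + 1) / 2) * 2) := by omega
      _ = (3 * 2 ^ ((t + 1) / 2)) ^ 2 := by rw [pow_mul]; ring
  exact lt_of_pow_lt_pow_left₀ 2 (by positivity) h3

/-- Transporter count at a non-dense source, BIG regime: if `3 s₀ < 2^(t+1)` then `tr · ⌊√s₀⌋ < 2^(t+1)`. -/
theorem tr_lt_big (hμ : ∀ c, μ c * μ c = 1) {s₀ t : ℕ} (y u : Fin n)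
    (hsparse : ∀ m, 1 ≤ m → m ≤ 2 * t → s₀ * (closedAt μ m y).card ≤ 2 ^ m) (hbig : 3 * s₀ < 2 ^ (t + 1)) :
    ((RW t).filter fun w => act μ y w = u).card * Nat.sqrt s₀ < 2 ^ (t + 1) := by
  set tr := ((RW t).filter fun w => act μ y w = u).card
  have h := Transporter.card_trAt_sq_le_of_sparse μ (involutive_of_mul_self μ hμ) t s₀ y u hsparse
  have h4 : 2 * 4 ^ t + 2 * 4 ^ t = (2 ^ (t + 1)) ^ 2 := by
    rw [show (4 : ℕ) = 2 ^ 2 by norm_num, ← pow_mul, pow_succ]; ring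
  have h1 : (tr * Nat.sqrt s₀) ^ 2 < (2 ^ (t + 1)) ^ 2 := by
    have hsq : Nat.sqrt s₀ ^ 2 ≤ s₀ := Nat.sqrt_le' s₀
    have h5 : 3 * s₀ * 2 ^ t < 2 * 4 ^ t := by
      rw [show 2 * 4 ^ t = 2 ^ (t + 1) * 2 ^ t by
        rw [show (4 : ℕ) = 2 ^ 2 by norm_num, ← pow_mul, pow_succ]; ring]
      exact Nat.mul_lt_mul_of_pos_right hbig (by positivity)
    calc (tr * Nat.sqrt s₀) ^ 2 = tr ^ 2 * Nat.sqrt s₀ ^ 2 := by ring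
      _ ≤ tr ^ 2 * s₀ := Nat.mul_le_mul_left _ hsq
      _ = s₀ * tr ^ 2 := by ring
      _ ≤ 3 * s₀ * 2 ^ t + 2 * 4 ^ t := h
      _ < 2 * 4 ^ t + 2 * 4 ^ t := Nat.add_lt_add_right h5 _
      _ = (2 ^ (t + 1)) ^ 2 := h4
  exact lt_of_pow_lt_pow_left₀ 2 (by positivity) h1

/-- **Hop, counting core.**  In a level `S` of depth `d` at a root whose point `p σ'` is not a dense spot, let `T₀ ⊆ S`
be "early touchers": each `β' ∈ T₀` reaches the fixed vertex `u` on side `σ'` at a time `tm β' ∈ (r, d/2]`.  If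
`|S| - 1 ≤ 8(d+1)|T₀|` and `288(d+1)² ≤ 2^(r/2)`, then some full-prefix class `{β ∈ S : β.take t = β'.take t}`,
`t = tm β'`, is GOOD: cheap (`2^(t+1) ≤ 3s₀` and it triples the density) or big (density times `√s₀ / (64(d+1)²)`).
Proof: otherwise, at each time `t` the touchers inject class-wise into the transporter words `p σ' → u` of length `t`,
whose number is `< 3·2^⌈t/2⌉` (cheap) / `< 2^(t+1)/√s₀` (big); either way `32(d+1)²·#(touchers of time t) < |S|`, and
summing over the `≤ d/2` times contradicts `|S| - 1 ≤ 8(d+1)|T₀|`. -/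
theorem hop_core (hμ : ∀ c, μ c * μ c = 1) {p : Bool → Fin n} {d : ℕ} {S : Finset (List (Fin 3))}
    (hI : Inv μ F r p d S) {s₀ : ℕ} (hs₀ : 0 < s₀) {σ' : Bool}
    (hsparse : ∀ m, 1 ≤ m → m ≤ 2 * d → s₀ * (closedAt μ m (p σ')).card ≤ 2 ^ m)
    (hr : 288 * (d + 1) ^ 2 ≤ 2 ^ (r / 2)) {u : Fin n} (T₀ : Finset (List (Fin 3))) (hT₀ : T₀ ⊆ S)
    (tm : List (Fin 3) → ℕ) (htm : ∀ β' ∈ T₀, r < tm β' ∧ 2 * tm β' ≤ d ∧ pos μ p β' σ' (tm β') = u)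
    (hbig : S.card - 1 ≤ 8 * (d + 1) * T₀.card) (hM : 2 ≤ S.card) :
    ∃ β' ∈ T₀,
      (2 ^ (tm β' + 1) ≤ 3 * s₀ ∧ 3 * S.card ≤ (S.filter fun β => β.take (tm β') = β'.take (tm β')).card * 2 ^ tm β') ∨
      S.card * Nat.sqrt s₀ ≤ (S.filter fun β => β.take (tm β') = β'.take (tm β')).card * 2 ^ tm β' * (64 * (d + 1) ^ 2) := by
  obtain ⟨_, hmem, _, _⟩ := hI
  set M := S.card with hMdef
  by_contra H
  push Not at H
  -- for every time t ∈ (r, d/2]: 32(d+1)² · #(touchers of time t) < M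
  have per_time : ∀ t, r < t → 2 * t ≤ d → 32 * (d + 1) ^ 2 * (T₀.filter fun β' => tm β' = t).card < M := by
    intro t hrt htd
    set Tt := T₀.filter fun β' => tm β' = t with hTt
    -- the prefix map into the transporter words
    set f : List (Fin 3) → List (Fin 3) := fun β' => β'.take t with hf
    have hmaps : ∀ β' ∈ Tt, f β' ∈ (RW t).filter fun w => act μ (p σ') w = u := by
      intro β' hβ'
      rw [hTt, Finset.mem_filter] at hβ'
      obtain ⟨hβ'T, hβ't⟩ := hβ'
      obtain ⟨hlen, hc, _, _⟩ := hmem β' (hT₀ hβ'T)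
      rw [Finset.mem_filter, mem_RW]
      refine ⟨⟨by simp [hf, hlen]; omega, hc.take t⟩, ?_⟩
      have := (htm β' hβ'T).2.2
      rw [hβ't] at this
      exact this
    -- each fibre of f inside Tt lies in a full-prefix class of S
    have hfib : ∀ β' ∈ Tt, (Tt.filter fun β => f β = f β').card ≤ (S.filter fun β => β.take t = β'.take t).card := by
      intro β' _
      refine Finset.card_le_card ?_
      intro β hβ
      rw [Finset.mem_filter] at hβ ⊢
      rw [hTt, Finset.mem_filter] at hβ
      exact ⟨hT₀ hβ.1.1, hβ.2⟩
    -- |Tt| = Σ over the image of the fibre sizes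
    have hsum : Tt.card = ∑ w ∈ Tt.image f, (Tt.filter fun β => f β = w).card :=
      Finset.card_eq_sum_card_image f Tt
    have himg : (Tt.image f).card ≤ ((RW t).filter fun w => act μ (p σ') w = u).card :=
      Finset.card_le_card (Finset.image_subset_iff.2 hmaps)
    have hsparse' : ∀ m, 1 ≤ m → m ≤ 2 * t → s₀ * (closedAt μ m (p σ')).card ≤ 2 ^ m :=
      fun m h1 h2 => hsparse m h1 (by omega)
    by_cases hcheap : 2 ^ (t + 1) ≤ 3 * s₀
    · -- cheap regime: every class is small: |G| · 2^t < 3M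
      have hsmall : ∀ w ∈ Tt.image f, (Tt.filter fun β => f β = w).card * 2 ^ t < 3 * M := by
        intro w hw
        rw [Finset.mem_image] at hw
        obtain ⟨β', hβ', rfl⟩ := hw
        have hβ'T : β' ∈ T₀ := (Finset.mem_filter.1 hβ').1
        have hβ't : tm β' = t := (Finset.mem_filter.1 hβ').2
        have := (H β' hβ'T).1 (by rw [hβ't]; exact hcheap)
        rw [hβ't] at this
        exact lt_of_le_of_lt (Nat.mul_le_mul_right _ (hfib β' hβ')) this
      have htr := tr_lt_cheap hμ hs₀ (p σ') u hsparse' hcheap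
      -- |Tt| · 2^t ≤ #image · 3M < 3 · 2^⌈t/2⌉ · 3M
      have h1 : Tt.card * 2 ^ t ≤ (Tt.image f).card * (3 * M) := by
        rw [hsum, Finset.sum_mul]
        calc ∑ w ∈ Tt.image f, (Tt.filter fun β => f β = w).card * 2 ^ t
            ≤ ∑ _w ∈ Tt.image f, 3 * M := Finset.sum_le_sum fun w hw => (hsmall w hw).le
          _ = (Tt.image f).card * (3 * M) := by rw [Finset.sum_const, smul_eq_mul]
      have h2 : Tt.card * 2 ^ t < 3 * 2 ^ ((t + 1) / 2) * (3 * M) := by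
        refine lt_of_le_of_lt h1 ?_
        rcases Nat.eq_zero_or_pos M with hM0 | hMpos
        · omega
        · exact Nat.mul_lt_mul_of_pos_right (lt_of_le_of_lt himg htr) (by omega)
      -- 2^t = 2^⌊t/2⌋ · 2^⌈t/2⌉ and 2^⌊t/2⌋ ≥ 2^(r/2) ≥ 288 (d+1)²
      have hsplit : 2 ^ t = 2 ^ (t / 2) * 2 ^ ((t + 1) / 2) := by rw [← pow_add]; congr 1; omega
      have h3 : Tt.card * 2 ^ (t / 2) < 9 * M := by
        have h2' : Tt.card * 2 ^ (t / 2) * 2 ^ ((t + 1) / 2) < 9 * M * 2 ^ ((t + 1) / 2) := by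
          calc Tt.card * 2 ^ (t / 2) * 2 ^ ((t + 1) / 2) = Tt.card * 2 ^ t := by rw [hsplit]; ring
            _ < 3 * 2 ^ ((t + 1) / 2) * (3 * M) := h2
            _ = 9 * M * 2 ^ ((t + 1) / 2) := by ring
        exact Nat.lt_of_mul_lt_mul_right h2'
      have h4 : 2 ^ (r / 2) ≤ 2 ^ (t / 2) := Nat.pow_le_pow_right (by norm_num) (by omega)
      have h5 : Tt.card * (288 * (d + 1) ^ 2) < 9 * M :=
        lt_of_le_of_lt (Nat.mul_le_mul_left _ (hr.trans h4)) h3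
      have h6 : Tt.card * (288 * (d + 1) ^ 2) = 9 * (32 * (d + 1) ^ 2 * Tt.card) := by ring
      omega
    · -- big regime: every class is small: |G| · 2^t · 64(d+1)² < M √s₀
      push Not at hcheap
      have hsmall : ∀ w ∈ Tt.image f, (Tt.filter fun β => f β = w).card * 2 ^ t * (64 * (d + 1) ^ 2) < M * Nat.sqrt s₀ := by
        intro w hw
        rw [Finset.mem_image] at hw
        obtain ⟨β', hβ', rfl⟩ := hw
        have hβ'T : β' ∈ T₀ := (Finset.mem_filter.1 hβ').1
        have hβ't : tm β' = t := (Finset.mem_filter.1 hβ').2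
        have := (H β' hβ'T).2
        rw [hβ't] at this
        exact lt_of_le_of_lt (Nat.mul_le_mul_right _ (Nat.mul_le_mul_right _ (hfib β' hβ'))) this
      have htr := tr_lt_big hμ (p σ') u hsparse' hcheap
      have hsq : 0 < Nat.sqrt s₀ := Nat.sqrt_pos.2 hs₀
      have h1 : Tt.card * 2 ^ t * (64 * (d + 1) ^ 2) ≤ (Tt.image f).card * (M * Nat.sqrt s₀) := by
        rw [hsum, Finset.sum_mul, Finset.sum_mul]
        calc ∑ w ∈ Tt.image f, (Tt.filter fun β => f β = w).card * 2 ^ t * (64 * (d + 1) ^ 2)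
            ≤ ∑ _w ∈ Tt.image f, M * Nat.sqrt s₀ := Finset.sum_le_sum fun w hw => (hsmall w hw).le
          _ = (Tt.image f).card * (M * Nat.sqrt s₀) := by rw [Finset.sum_const, smul_eq_mul]
      -- multiply by √s₀ and use tr · √s₀ < 2^(t+1)
      have h2 : Tt.card * 2 ^ t * (64 * (d + 1) ^ 2) * Nat.sqrt s₀ < 2 ^ (t + 1) * (M * Nat.sqrt s₀) := by
        rcases Nat.eq_zero_or_pos M with hM0 | hMpos
        · omega
        calc Tt.card * 2 ^ t * (64 * (d + 1) ^ 2) * Nat.sqrt s₀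
            ≤ (Tt.image f).card * (M * Nat.sqrt s₀) * Nat.sqrt s₀ := Nat.mul_le_mul_right _ h1
          _ = (Tt.image f).card * Nat.sqrt s₀ * (M * Nat.sqrt s₀) := by ring
          _ ≤ ((RW t).filter fun w => act μ (p σ') w = u).card * Nat.sqrt s₀ * (M * Nat.sqrt s₀) :=
              Nat.mul_le_mul_right _ (Nat.mul_le_mul_right _ himg)
          _ < 2 ^ (t + 1) * (M * Nat.sqrt s₀) := Nat.mul_lt_mul_of_pos_right htr (by positivity)
      have h3 : Tt.card * (32 * (d + 1) ^ 2) * (2 ^ (t + 1) * Nat.sqrt s₀) < M * (2 ^ (t + 1) * Nat.sqrt s₀) := by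
        calc Tt.card * (32 * (d + 1) ^ 2) * (2 ^ (t + 1) * Nat.sqrt s₀)
            = Tt.card * 2 ^ t * (64 * (d + 1) ^ 2) * Nat.sqrt s₀ := by rw [pow_succ]; ring
          _ < 2 ^ (t + 1) * (M * Nat.sqrt s₀) := h2
          _ = M * (2 ^ (t + 1) * Nat.sqrt s₀) := by ring
      have h4 := Nat.lt_of_mul_lt_mul_right h3
      rw [Nat.mul_comm] at h4
      exact h4
  -- sum over the times: |T₀| = Σ_{t ∈ (r, d/2]} #(touchers of time t)
  have hcover : ∀ β' ∈ T₀, tm β' ∈ Finset.Ioc r (d / 2) := by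
    intro β' hβ'
    rw [Finset.mem_Ioc]
    exact ⟨(htm β' hβ').1, by have := (htm β' hβ').2.1; omega⟩
  have hsumT : T₀.card = ∑ t ∈ Finset.Ioc r (d / 2), (T₀.filter fun β' => tm β' = t).card :=
    Finset.card_eq_sum_card_fiberwise hcover
  have hbound : 32 * (d + 1) ^ 2 * T₀.card ≤ (d / 2) * (M - 1) := by
    rw [hsumT, Finset.mul_sum]
    calc ∑ t ∈ Finset.Ioc r (d / 2), 32 * (d + 1) ^ 2 * (T₀.filter fun β' => tm β' = t).card
        ≤ ∑ _t ∈ Finset.Ioc r (d / 2), (M - 1) := by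
          refine Finset.sum_le_sum fun t ht => ?_
          rw [Finset.mem_Ioc] at ht
          have := per_time t ht.1 (by omega)
          omega
      _ = (Finset.Ioc r (d / 2)).card * (M - 1) := by rw [Finset.sum_const, smul_eq_mul]
      _ ≤ (d / 2) * (M - 1) := by rw [Nat.card_Ioc]; exact Nat.mul_le_mul_right _ (by omega)
  -- combine with |S| - 1 ≤ 8(d+1)|T₀|
  have h6 : 4 * (d + 1) * (M - 1) ≤ 32 * (d + 1) ^ 2 * T₀.card := by
    calc 4 * (d + 1) * (M - 1) ≤ 4 * (d + 1) * (8 * (d + 1) * T₀.card) := Nat.mul_le_mul_left _ hbig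
      _ = 32 * (d + 1) ^ 2 * T₀.card := by ring
  have h7 : 4 * (d + 1) * (M - 1) ≤ (d / 2) * (M - 1) := h6.trans hbound
  have h8 : d / 2 < 4 * (d + 1) := by omega
  have h9 : 0 < M - 1 := by omega
  exact absurd h7 (not_le.2 (Nat.mul_lt_mul_of_pos_right h8 h9))


end Main

end CleanPair

open CleanPair in
/-- **`stub_hopCore`** (registered sub-goal of stmt-MatrixMultiplication-10883): the counting core of the hop (ATOM_PROOF §4), in the
landed `CleanPair` vocabulary. -/
theorem stub_hopCore : ∀ (n r d s₀ : ℕ) (μ : Fin 3 → Equiv.Perm (Fin n)) (F : Finset (Fin n)) (p : Bool → Fin n) (S T₀ : Finset (List (Fin 3))) (σ' : Bool) (u : Fin n) (tm : List (Fin 3) → ℕ), (∀ c, μ c * μ c = 1) → Summit.MatrixMultiplication.MatrixMultiplication.Theorems.HyperoctahedralThreshold.CleanPair.Inv μ F r p d S → 0 < s₀ → (∀ m, 1 ≤ m → m ≤ 2 * d → s₀ * (Summit.MatrixMultiplication.MatrixMultiplication.Theorems.HyperoctahedralThreshold.TwinSupplyCS.closedAt μ m (p σ')).card ≤ 2 ^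 m) → 288 * (d + 1) ^ 2 ≤ 2 ^ (r / 2) → T₀ ⊆ S → (∀ β' ∈ T₀, r < tm β' ∧ 2 * tm β' ≤ d ∧ Summit.MatrixMultiplication.MatrixMultiplication.Theorems.HyperoctahedralThreshold.CleanPair.pos μ p β' σ' (tm β') = u) → S.card - 1 ≤ 8 * (d + 1) * T₀.card → 2 ≤ S.card → ∃ β' ∈ T₀, (2 ^ (tm β' + 1) ≤ 3 * s₀ ∧ 3 * S.card ≤ (S.filter fun β => β.take (tm β') = β'.take (tm β')).card * 2 ^ tm β') ∨ S.card * Nat.sqrt s₀ ≤ (S.filter fun β => β.take (tm β') = β'.take (tm β')).card * 2 ^ tm β' * (64 * (d + 1) ^ 2) :=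
  fun _ _ _ _ _ _ _ _ T₀ _ _ tm hμ hI hs₀ hsp hr hT htm hbig hM => hop_core hμ hI hs₀ hsp hr T₀ hT tm htm hbig hM

end Summit.MatrixMultiplication.MatrixMultiplication.Theorems.HyperoctahedralThreshold
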